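import Summits.CriticalPhenomena.PercolationContinuityZ3.Theorems.Transplant.PlanarSkeletonFrmFromDefs
import Summits.CriticalPhenomena.PercolationContinuityZ3.Theorems.Transplant.SkelFrmFromBParamsSchedAT
import Summits.CriticalPhenomena.PercolationContinuityZ3.Theorems.Transplant.SkelFrmBParamsSchedAT
import Summits.CriticalPhenomena.PercolationContinuityZ3.Theorems.Transplant.SkelFrmFromBParamsExcess
import Summits.CriticalPhenomena.PercolationContinuityZ3.Theorems.Transplant.SkelFrmBParamsExcess
import Summits.CriticalPhenomena.PercolationContinuityZ3.Theorems.Transplant.SkelPhiFatRadius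
import Summits.CriticalPhenomena.PercolationContinuityZ3.Theorems.Transplant.SkelConcRootRadii
import Summits.CriticalPhenomena.PercolationContinuityZ3.Theorems.Transplant.SkelNegBParamsSlotsSU
import Summits.CriticalPhenomena.PercolationContinuityZ3.Theorems.Transplant.SkelFrmFromBParamsSlotsS
import Summits.CriticalPhenomena.PercolationContinuityZ3.Theorems.Transplant.SkelFrmBParamsSlotsS
import HarnessLib
import Summits.CriticalPhenomena.PercolationContinuityZ3.Theorems.Transplant.SkelFrmBParamsSlotsST
/-!
# U-WAVE PORT (RULING D-U, lead g21 2026-08-26; WAVE-U-MANIFEST v3.1 row «SkelFrmBParamsSlotsST» ↦ «SkelFrmFromBParamsSlotsST») of the tree module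
# `Transplant/SkelFrmBParamsSlotsST` onto the carrier `PlanarSkeletonFrmFrom` (frames only, cylinders connected from width `ℓ₀` on)

ORIGINAL TITLE: (R-40) `…T` TWIN (stmt-g21, 2026-08-23; ruling p3-g16 06:23:56Z, J18; lead g11 06:35:07Z: the choice function of record moves to `frmChoiceAllQ3T`): the twin of

builds on p205010 (kernel theorem, internal audit signed; external expert review pending) — nothing in this file uses p205010; NOTHING is claimed about the
OPEN node U `SamePDropOfSkeletonFrmFrom₁` (nor U_s / the end state).  Lane `prim-bschramm`, seat `prim-bschramm-stmt` gen 26 (port pen, RULING M-11 family P-stmt; tool = p3-g26's port_u.py of record, registry-driven inputs); helper file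
(`--supports stmt-CriticalPhenomena-4575 --as helper`).  PORT RULES r1–r4 of RULING D-U: declaration order and proof texts are those of the original,
byte-identical except (i) the carrier token `PlanarSkeletonFrm ↦ PlanarSkeletonFrmFrom` (binders, `namespace`/`end` lines, qualified names of twinned
declarations), (ii) carrier-FREE declarations of the original (φ-level `Skelφ…` blocks and namespace-only arithmetic residents) are NOT re-declared —
this file imports the original and `export`s the twin-free residents (POLICY T / treatment (m1)); residents whose statement mentions a twinned
constant are copied, (iii) every carrier-binding declaration keeps its explicit binder `(Φ : PlanarSkeletonFrmFrom G)` in its own signature (r2).  Docstrings and citations are the original's.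
-/

noncomputable section

open scoped Classical

namespace Summit.CriticalPhenomena.PercolationContinuityZ3.Theorems.Transplant

namespace PlanarSkeletonFrmFrom

namespace NegB

open MeasureTheory Literature.Probability.Percolation Literature.Probability.LatticeModels SimpleGraph
open Literature.Barriers.CriticalPhenomena (graphBall)
open SkelConc (Consts)
open BoxProdZ2 (ConcRadiiG Erad Frad nQ)
open Skelφ (oriφ trφ)
open Skelφ.StepI (DataN DataNS)
open Skel (excess)
open Neg

/-! ## §1 The residual slot type, the seed's fat radius, the φ-diameter of a rim habitat -/

-- (cell-free, not re-declared: `GSlot` of SkelFrmBParamsSlotsS)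

-- (cell-free, not re-declared: `GSlot.zero` of SkelFrmBParamsSlotsS)

-- (cell-free, not re-declared: `ψπ` of SkelFrmBParamsSlotsS)

-- (cell-free, not re-declared: `ψπ_eq` of SkelFrmBParamsSlotsS)

section Values

variable (κ : Consts) {V : Type} [DecidableEq V] [Countable V] {G : SimpleGraph V} [G.LocallyFinite] (Φ : PlanarSkeletonFrmFrom G) (t : V)
  (p : unitInterval) (D : DataNS V) (g f mx : ℕ)

-- (cell-free, not re-declared: `mRS` of SkelFrmBParamsSlotsS)

-- (cell-free, not re-declared: `mRS_ge` of SkelFrmBParamsSlotsS)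

-- (cell-free, not re-declared: `fine_diam_le_mRS` of SkelFrmBParamsSlotsS)

end Values

/-! ## §2 The fibre block of record over the staggered cells -/

-- (cell-free, not re-declared: `SUS` of SkelFrmBParamsSlotsS)

section Facts

variable (κ : Consts) {V : Type} [DecidableEq V] [Countable V] {G : SimpleGraph V} [G.LocallyFinite] (Φ : PlanarSkeletonFrmFrom G) (t : V)
  (p : unitInterval) (D : DataNS V) (g f : ℕ) (ex mx : GSlot) (q : unitInterval)

-- (cell-free, not re-declared: `SUS_fields` of SkelFrmBParamsSlotsS)

-- (cell-free, not re-declared: `SUS_rmax_ge` of SkelFrmBParamsSlotsS)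

-- (cell-free, not re-declared: `hgap20_US` of SkelFrmBParamsSlotsS)

-- (cell-free, not re-declared: `hgapc_US` of SkelFrmBParamsSlotsS)

-- (cell-free, not re-declared: `hgapR_US` of SkelFrmBParamsSlotsS)

-- (cell-free, not re-declared: `hgapL_US` of SkelFrmBParamsSlotsS)

-- (cell-free, not re-declared: `ex_le_Lp_US` of SkelFrmBParamsSlotsS)

-- (cell-free, not re-declared: `three_le_E₀_US` of SkelFrmBParamsSlotsS)

-- (cell-free, not re-declared: `hsch_US` of SkelFrmBParamsSlotsS)

-- (cell-free, not re-declared: `Rex_mono_US` of SkelFrmBParamsSlotsS)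

-- (cell-free, not re-declared: `hR₁_US` of SkelFrmBParamsSlotsS)

-- (cell-free, not re-declared: `hRex_US` of SkelFrmBParamsSlotsS)

-- (cell-free, not re-declared: `hR₁_US_η` of SkelFrmBParamsSlotsS)

-- (cell-free, not re-declared: `E₀_SUS_eq` of SkelFrmBParamsSlotsS)

-- (cell-free, not re-declared: `Lp_SUS_eq` of SkelFrmBParamsSlotsS)

end Facts

/-! ## §3 The root radius `Rπ := E₀ − 1` (any block) and the four root radii at the schedule of record -/

section RootRadii

variable (κ : Consts) {V : Type} [DecidableEq V] [Countable V] {G : SimpleGraph V} [G.LocallyFinite] (Φ : PlanarSkeletonFrmFrom G) (t : V)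
  (p : unitInterval) (D : DataNS V) (g f : ℕ) (c : Fin 2 → ℕ) (Sv : SSlot) (q : unitInterval)

-- (cell-free, not re-declared: `Rπ` of SkelFrmBParamsSlotsS)

-- (cell-free, not re-declared: `Rπ_succ` of SkelFrmBParamsSlotsS)

/-- **`hRQ`**: `Rπ + 1 ≤ rQ 0 0` (`rQ 0 0 = E (nQ 0 0) ⊔ … ≥ E₀`). [folklore] -/
theorem hRQ_RT (κ : Consts) {V : Type} [DecidableEq V] [Countable V] {G : SimpleGraph V} [G.LocallyFinite] (Φ : PlanarSkeletonFrmFrom G) (t : V) (p : unitInterval) (D : DataNS V) (g : ℕ) (f : ℕ) (c : Fin 2 → ℕ) (Sv : SSlot) (q : unitInterval) : Rπ κ Φ t p D g f Sv q + 1 ≤ (schedOfT κ Φ t p D g f c (Sv κ Φ t p D g f q)).rQ 0 0 := by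
  rw [Rπ_succ]
  show _ ≤ max (Erad (Skelφ.Prm.gap (Sv κ Φ t p D g f q)) (fun _ => 0) (Skelφ.Prm.E₀ (Sv κ Φ t p D g f q)) (nQ 0 0)) _
  exact le_trans (Skel.E₀_le_Erad _ _ _ _) (le_max_left _ _)

/-- **`hRB`**: `Rπ + 1 ≤ rB 0 0 du` (`= E (nQ 0 (0+du))`). [folklore] -/
theorem hRB_RT (κ : Consts) {V : Type} [DecidableEq V] [Countable V] {G : SimpleGraph V} [G.LocallyFinite] (Φ : PlanarSkeletonFrmFrom G) (t : V) (p : unitInterval) (D : DataNS V) (g : ℕ) (f : ℕ) (c : Fin 2 → ℕ) (Sv : SSlot) (q : unitInterval) (du : MDir) : Rπ κ Φ t p D g f Sv q + 1 ≤ (schedOfT κ Φ t p D g f c (Sv κ Φ t p D g f q)).rB 0 0 du := by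
  rw [Rπ_succ]
  show _ ≤ Erad (Skelφ.Prm.gap (Sv κ Φ t p D g f q)) (fun _ => 0) (Skelφ.Prm.E₀ (Sv κ Φ t p D g f q)) (nQ 0 (0 + stepVec du))
  exact Skel.E₀_le_Erad _ _ _ _

/-- **`hRQ′`**: `Rπ + 1 ≤ rQ 0 (0 + du)`. [folklore] -/
theorem hRQ'_RT (κ : Consts) {V : Type} [DecidableEq V] [Countable V] {G : SimpleGraph V} [G.LocallyFinite] (Φ : PlanarSkeletonFrmFrom G) (t : V) (p : unitInterval) (D : DataNS V) (g : ℕ) (f : ℕ) (c : Fin 2 → ℕ) (Sv : SSlot) (q : unitInterval) (du : MDir) : Rπ κ Φ t p D g f Sv q + 1 ≤ (schedOfT κ Φ t p D g f c (Sv κ Φ t p D g f q)).rQ 0 ((0 : Site 2) + stepVec du) := by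
  rw [Rπ_succ]
  show _ ≤ max (Erad (Skelφ.Prm.gap (Sv κ Φ t p D g f q)) (fun _ => 0) (Skelφ.Prm.E₀ (Sv κ Φ t p D g f q)) (nQ 0 ((0 : Site 2) + stepVec du))) _
  exact le_trans (Skel.E₀_le_Erad _ _ _ _) (le_max_left _ _)

/-- **`hRM`**: `Rπ + 1 ≤ rM 0 (0 + du)` (`rM 0 (0+du) = F 1 − L′ = E₀ + gap E₀ − L′ ≥ E₀` since `L′ ≤ gap`). [folklore] -/
theorem hRM_RT (κ : Consts) {V : Type} [DecidableEq V] [Countable V] {G : SimpleGraph V} [G.LocallyFinite] (Φ : PlanarSkeletonFrmFrom G) (t : V) (p : unitInterval) (D : DataNS V) (g : ℕ) (f : ℕ) (c : Fin 2 → ℕ) (Sv : SSlot) (q : unitInterval) (du : MDir) : Rπ κ Φ t p D g f Sv q + 1 ≤ (schedOfT κ Φ t p D g f c (Sv κ Φ t p D g f q)).rM 0 ((0 : Site 2) + stepVec du) := by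
  rw [Rπ_succ]
  show _ ≤ Frad (Skelφ.Prm.gap (Sv κ Φ t p D g f q)) (fun _ => 0) (Skelφ.Prm.E₀ (Sv κ Φ t p D g f q)) (nQ 0 ((0 : Site 2) + stepVec du)) - Skelφ.Prm.Lp (Sv κ Φ t p D g f q)
  rw [Skel.nQ_zero_stepVec, BoxProdZ2.Frad_succ, BoxProdZ2.Erad_zero]
  have h := Skelφ.Prm.hgapL (Sv κ Φ t p D g f q) (Skelφ.Prm.E₀ (Sv κ Φ t p D g f q))
  omega

-- (cell-free, not re-declared: `le_Rπ_of` of SkelFrmBParamsSlotsS)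

-- (cell-free, not re-declared: `le_Rπ_of_reachK` of SkelFrmBParamsSlotsS)

end RootRadii

/-! ## §4 The `Rπ`-inequalities of the root residue at `SUS`, as floors on `ex` -/

section RootSU

variable (κ : Consts) {V : Type} [DecidableEq V] [Countable V] {G : SimpleGraph V} [G.LocallyFinite] (Φ : PlanarSkeletonFrmFrom G) (t : V)
  (p : unitInterval) (D : DataNS V) (g f : ℕ) (ex mx : GSlot) (q : unitInterval)

-- (cell-free, not re-declared: `ex_le_Rπ` of SkelFrmBParamsSlotsS)

-- (cell-free, not re-declared: `fat_le_Rπ` of SkelFrmBParamsSlotsS)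

-- (cell-free, not re-declared: `Rex_fat_le_Rπ_sub` of SkelFrmBParamsSlotsS)

-- (cell-free, not re-declared: `SRex_fat_le_Rπ_sub` of SkelFrmBParamsSlotsS)

end RootSU

end NegB

end PlanarSkeletonFrmFrom

end Summit.CriticalPhenomena.PercolationContinuityZ3.Theorems.Transplant

end
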